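import Literature.Claims.NS.Jackson2022
import Literature.Analysis.FluidPDE.PeriodicGalileanNonuniqueness
import HarnessLib

/-!
# C82 `Jackson2022` — kernel certificate for the NS-claims sweep (D-0090), refuter-8

Typed record: `Literature.Claims.NS.Jackson2022` (typist-4 g2, p484405), R. L. Jackson, OJFD 12 (2022)
86–95: Thm 4.2.3 / Conclusion p.94.

Kernel fact (sorry-free, standard axioms):

* `not_ClaimedNegativeForced` — the forced sentence of the Conclusion p.94 («there are no velocity
  vector fields v, under an external force f, that can satisfy both criteria set by the Clay Mathematics
  Institute»), typed as: for every `ν > 0` and every smooth force that is not identically zero there is NO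
  smooth bounded-energy solution, is false. Countermodel (hydrostatic balance): the constant force
  `f ≡ e₀`, the rest velocity `u ≡ 0` with datum `0`, and the linear pressure `p(t, x) = ⟪e₀, x⟫`, whose
  gradient is `e₀`; the pair is `C^∞` on `ℝ³ × [0,∞)`, solves (1)–(3) with force `f`, and has zero
  kinetic energy.

The unforced half («both the Millennium prize criteria are satisfied» by one exhibited field) is the
bridge `step_bridge_iff_clayA` of the skeleton (Δ4/Δ6), and the displayed field has no admissible real
parameters (`no_real_printedRadical`); nothing further is filed on those.

WHAT THIS IS NOT: not a claim about NS regularity or blow-up; not a claim about any author beyond the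
typed locator.
-/

set_option linter.dupNamespace false

noncomputable section

open Set Function MeasureTheory
open scoped ContDiff InnerProductSpace
open Literature.Analysis.FluidPDE

namespace Summit.NavierStokesRegularity.NavierStokesRegularity.Theorems.Jackson2022

/-- The direction of the constant force, `e₀ = (1, 0, 0)`. [folklore] -/
def e0 : EuclideanSpace ℝ (Fin 3) := EuclideanSpace.single 0 1

/-- The constant force field `f(t, x) = e₀`. [folklore] -/
def constForce : ℝ → EuclideanSpace ℝ (Fin 3) → EuclideanSpace ℝ (Fin 3) := fun _ _ => e0

/-- The hydrostatic pressure `p(t, x) = ⟪e₀, x⟫` balancing the constant force. [folklore] -/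
def linPressure : ℝ → EuclideanSpace ℝ (Fin 3) → ℝ :=
  fun _ x => InnerProductSpace.toDual ℝ (EuclideanSpace ℝ (Fin 3)) e0 x

/-- `e₀ ≠ 0`. [folklore] -/
theorem e0_ne_zero : e0 ≠ 0 := by
  intro h
  have := congrArg (fun v : EuclideanSpace ℝ (Fin 3) => v 0) h
  simp [e0] at this

/-- The gradient of the linear pressure is the force: `∇p(t, ·) = e₀`. [folklore] -/
theorem gradient_linPressure (t : ℝ) (x : EuclideanSpace ℝ (Fin 3)) :
    gradient (linPressure t) x = e0 := by
  unfold linPressure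
  rw [gradient, ContinuousLinearMap.fderiv]
  exact (InnerProductSpace.toDual ℝ (EuclideanSpace ℝ (Fin 3))).symm_apply_apply e0

/-- The hydrostatic pair (`u ≡ 0`, `p = ⟪e₀, ·⟫`) solves Fefferman's (1)–(3) with the constant force
`e₀` and datum `0`. [folklore] -/
theorem isNavierStokesSolution_hydrostatic (ν : ℝ) :
    IsNavierStokesSolution ν constForce 0 (0 : ℝ → EuclideanSpace ℝ (Fin 3) → EuclideanSpace ℝ (Fin 3))
      linPressure := by
  obtain ⟨hz, -, -⟩ := isNavierStokesSolution_zero (E := EuclideanSpace ℝ (Fin 3)) ν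
  refine ⟨fun t ht x => ?_, hz.divFree, rfl⟩
  rw [hz.momentum t ht x, gradient_linPressure]
  have h0 : gradient ((0 : ℝ → EuclideanSpace ℝ (Fin 3) → ℝ) t) x = 0 := by
    rw [Pi.zero_apply, show (0 : EuclideanSpace ℝ (Fin 3) → ℝ) = fun _ => (0 : ℝ) from rfl,
      gradient_fun_const]
  rw [h0]
  simp [constForce]

/-- **The forced sentence of the Conclusion p.94 is false (C82).** Witness: `ν = 1`, the constant
non-zero smooth force `e₀`, and the smooth bounded-energy hydrostatic solution (`u ≡ 0`, `p = ⟪e₀, ·⟫`).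
[cite: Jackson2022, Thm 4.2.3 p.94; Conclusion p.94] -/
theorem not_ClaimedNegativeForced : ¬ Literature.Claims.NS.Jackson2022.ClaimedNegativeForced := by
  intro h
  obtain ⟨-, hsu, -⟩ := isNavierStokesSolution_zero (E := EuclideanSpace ℝ (Fin 3)) (1 : ℝ)
  refine h 1 one_pos constForce contDiffOn_const ⟨0, le_rfl, 0, by simpa [constForce] using e0_ne_zero⟩
    ⟨0, 0, linPressure, hsu, ?_, isNavierStokesSolution_hydrostatic 1, ⟨0, by simp, fun t _ => by simp⟩⟩
  exact ((InnerProductSpace.toDual ℝ (EuclideanSpace ℝ (Fin 3)) e0).contDiff.comp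
    contDiff_snd).contDiffOn

end Summit.NavierStokesRegularity.NavierStokesRegularity.Theorems.Jackson2022

end
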